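import Summits.CriticalPhenomena.PercolationContinuityZ3.Theorems.PercNearOneGluingNoHeavyLowerTailAntitheticBoxes
import HarnessLib

/-!
# `NoHeavyLowerTail` (stmt-CriticalPhenomena-4575) — antithetic cluster pairs: **BOXES SURVIVE FREEZING** (⊕ ⇒ M), prim-hp-2 gen 63

Support file (`--supports stmt-CriticalPhenomena-4575`, hull-port prover `prim-hp-2`, gen 63).  No definitions, no named facts, no sorries;
standard axioms.  VERTEX version; notation of …AntitheticBoxes: colourings `T ⊆ Sym2 V`, edge set `E`, source `s`,
`X T = openCluster (T ∩ E) s` (red cluster), `Y T = openCluster (Tᶜ ∩ E) s` (blue cluster); a BOX is `{T : T agrees with N on Fix}`,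
RED-DOMINATED if `Y T' ⊆ X T` for members `T, T'` opposite off `Fix`; 𝒮 = super-odd twisted-monotone pairs `K₁, K₂`.

THEOREM (⊕ ⇒ M, HOME/MEMO-gen63.md §1).  Let an event `D` be partitioned into red-dominated boxes `B_c` (cover / inside / uniqueness /
domination, exactly the hypotheses of `Antithetic.Box.boxes_sum_nonneg`) and let `L` be any set of vertices.  For a colouring `T` let
`Z(T)` be the union of the BLUE clusters of the vertices of `L` and `Φ(T)` ("freezing fibre") the set of colourings agreeing with `T` on every
pair meeting `Z(T)`.  If no vertex of `L` is blue-joined to `s` in `T` (`s ∉ Z(T)`), then `B_c ∩ Φ(T)` is again a red-dominated box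
(`Antithetic.Box.dom_freeze`): it is the box with fixed set `Fix c ∪ {pairs meeting Z(T)}`; for members `M, M'` opposite off this set, the
`B_c`-antipode `M*` of `M` differs from `M'` only on pairs meeting `Z`, the boundary pairs of `Z` are red in `M'`, so a blue path from `s` in
`M'` never touches `Z` and is a blue path of `M*`: `Y M' ⊆ Y M* ⊆ X M`.  These boxes partition `D ∩ {no vertex of L in Y}`.  Hence:
* `Antithetic.Box.freeze_boxes_sum_nonneg` — `0 ≤ Σ_{T ∈ D, L ∩ Y T = ∅} K₁(X T, Y T)·K₂(X T, Y T)` for all `K₁, K₂ ∈ 𝒮`.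
* `Antithetic.Box.notY_sum_nonneg` — the case `D` = everything (one box, nothing fixed): `0 ≤ Σ_{T : L ∩ Y T = ∅} K₁K₂` on EVERY graph
  (block freezing, HOME/THEOREM-OneSided.md Lemma 2, in box language and super-odd `K`-form).
* `Antithetic.Box.mixed_of_oplus_boxes` — a red-dominated box partition of the ⊕-event `{P ∈ X}` gives, for every vertex `Q`,
  `0 ≤ TII_E(P, Q; K) = Σ_{T : P ∈ X T, Q ∉ Y T} K₁K₂` for all `K ∈ 𝒮`: hypothesis (M) of the HANDLE PRINCIPLE
  (`Antithetic.Pendant.handle_vertex_sum_nonneg_of`) FOLLOWS from ⊕-boxes of `(K, s, P)` — e.g. PR4 on cycles (…AntitheticCycleTII) from the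
  PTR boxes of THEOREM ⊕-CYCLE.
* `Antithetic.Box.mixed_source_nonneg` — the shape of (M) with `P = s`, on every graph.
[cite: VandenbergHaggstromKahn2005, §1 p. 6 ("Harris' inequality"), §1 p. 3 (open cluster `C_s`)]
-/

noncomputable section

namespace Summit.CriticalPhenomena.PercolationContinuityZ3.Theorems

open Literature.Probability.Percolation
open scoped Classical

namespace Antithetic

namespace Box

variable {V : Type*}

open Freeze in
/-- **A red-dominated box stays red-dominated when a sealed set is frozen.**  `(Fix, N)` a red-dominated box; `Z ∌ s` a vertex set;
`T₀` a colouring in which every `E`-pair from outside `Z` into `Z` is red.  If `M, M'` agree with `N` on `Fix` and with `T₀` on the pairs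
meeting `Z`, and are opposite on all other pairs, then `Y M' ⊆ X M`. [this work] -/
theorem dom_freeze (E : Set (Sym2 V)) (s : V) (Fix N : Set (Sym2 V))
    (hdom : ∀ T T' : Set (Sym2 V), (∀ e ∈ Fix, (e ∈ T ↔ e ∈ N)) → (∀ e ∈ Fix, (e ∈ T' ↔ e ∈ N)) →
      (∀ e ∉ Fix, (e ∈ T' ↔ e ∉ T)) → openCluster (T'ᶜ ∩ E) s ⊆ openCluster (T ∩ E) s)
    (Z : Set V) (hsZ : s ∉ Z) (T₀ : Set (Sym2 V)) (hbd : ∀ a b : V, a ∉ Z → b ∈ Z → s(a, b) ∈ E → s(a, b) ∈ T₀)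
    (M M' : Set (Sym2 V)) (hMFix : ∀ e ∈ Fix, (e ∈ M ↔ e ∈ N)) (hM'Fix : ∀ e ∈ Fix, (e ∈ M' ↔ e ∈ N))
    (hM'Z : ∀ e : Sym2 V, (∃ v ∈ Z, v ∈ e) → (e ∈ M' ↔ e ∈ T₀))
    (hflip : ∀ e : Sym2 V, e ∉ Fix → (¬ ∃ v ∈ Z, v ∈ e) → (e ∈ M' ↔ e ∉ M)) :
    openCluster (M'ᶜ ∩ E) s ⊆ openCluster (M ∩ E) s := by
  -- the antipode of `M` in the box `(Fix, N)`
  let Mst : Set (Sym2 V) := {e | (e ∈ Fix ∧ e ∈ M) ∨ (e ∉ Fix ∧ e ∉ M)}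
  have hMst_Fix : ∀ e ∈ Fix, (e ∈ Mst ↔ e ∈ N) := by
    intro e he
    rw [← hMFix e he]
    simp only [Mst, Set.mem_setOf_eq]
    exact ⟨fun h => h.elim (fun h => h.2) (fun h => absurd he h.1), fun h => Or.inl ⟨he, h⟩⟩
  have hMst_flip : ∀ e ∉ Fix, (e ∈ Mst ↔ e ∉ M) := by
    intro e he
    simp only [Mst, Set.mem_setOf_eq]
    exact ⟨fun h => h.elim (fun h => absurd h.1 he) (fun h => h.2), fun h => Or.inr ⟨he, h⟩⟩
  have hdomst : openCluster (Mstᶜ ∩ E) s ⊆ openCluster (M ∩ E) s := hdom M Mst hMFix hMst_Fix hMst_flip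
  intro v hv
  refine hdomst (reachable_of_sealed (Mstᶜ ∩ E) (M'ᶜ ∩ E) s Z hsZ ?_ ?_ hv).1
  · -- outside `Z`, the blue graphs of `M'` and `Mst` agree
    intro a b ha hb
    have hnm : ¬ ∃ v ∈ Z, v ∈ s(a, b) := by
      rintro ⟨v, hv, hve⟩
      rcases Sym2.mem_iff.1 hve with rfl | rfl
      · exact ha hv
      · exact hb hv
    by_cases hab : s(a, b) ∈ Fix
    · have h1 : s(a, b) ∈ M' ↔ s(a, b) ∈ Mst := by rw [hM'Fix _ hab, hMst_Fix _ hab]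
      simp only [Set.mem_inter_iff, Set.mem_compl_iff]
      rw [h1]
    · have h1 : s(a, b) ∈ M' ↔ s(a, b) ∈ Mst := by rw [hflip _ hab hnm, hMst_flip _ hab]
      simp only [Set.mem_inter_iff, Set.mem_compl_iff]
      rw [h1]
  · -- `Z` is sealed in the blue graph of `M'`: boundary pairs are red
    intro a b ha hb hab
    exact hab.1 ((hM'Z _ ⟨b, hb, Sym2.mem_mk_right a b⟩).2 (hbd a b ha hb hab.2))

variable [Fintype V]

open Freeze in
/-- **Boxes survive freezing.**  `D` an event partitioned into red-dominated boxes `(Fix c, N c)` (cover, inside, uniqueness, domination as in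
`boxes_sum_nonneg`), `L` a set of vertices.  Then for all super-odd twisted-monotone `K₁, K₂`:
`0 ≤ Σ_{T ∈ D : no vertex of L lies in Y T} K₁(X T, Y T)·K₂(X T, Y T)`. [this work] -/
theorem freeze_boxes_sum_nonneg {C : Type*} (E : Set (Sym2 V)) (s : V) (D : Finset (Set (Sym2 V))) (Fix N : C → Set (Sym2 V))
    (hcover : ∀ T ∈ D, ∃ c, ∀ e ∈ Fix c, (e ∈ T ↔ e ∈ N c))
    (hinside : ∀ c (T : Set (Sym2 V)), (∀ e ∈ Fix c, (e ∈ T ↔ e ∈ N c)) → T ∈ D)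
    (huniq : ∀ c c' (T : Set (Sym2 V)), (∀ e ∈ Fix c, (e ∈ T ↔ e ∈ N c)) → (∀ e ∈ Fix c', (e ∈ T ↔ e ∈ N c')) → c = c')
    (hdom : ∀ c (T T' : Set (Sym2 V)), (∀ e ∈ Fix c, (e ∈ T ↔ e ∈ N c)) → (∀ e ∈ Fix c, (e ∈ T' ↔ e ∈ N c)) →
      (∀ e ∉ Fix c, (e ∈ T' ↔ e ∉ T)) → openCluster (T'ᶜ ∩ E) s ⊆ openCluster (T ∩ E) s)
    (L : Set V) {K₁ K₂ : Set V → Set V → ℝ}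
    (hK₁ : ∀ ⦃P P' Q Q' : Set V⦄, P ⊆ P' → Q' ⊆ Q → K₁ P Q ≤ K₁ P' Q') (hso₁ : ∀ P Q, 0 ≤ K₁ P Q + K₁ Q P)
    (hK₂ : ∀ ⦃P P' Q Q' : Set V⦄, P ⊆ P' → Q' ⊆ Q → K₂ P Q ≤ K₂ P' Q') (hso₂ : ∀ P Q, 0 ≤ K₂ P Q + K₂ Q P) :
    0 ≤ ∑ T ∈ D.filter (fun T => ∀ Q ∈ L, Q ∉ openCluster (Tᶜ ∩ E) s),
      K₁ (openCluster (T ∩ E) s) (openCluster (Tᶜ ∩ E) s) * K₂ (openCluster (T ∩ E) s) (openCluster (Tᶜ ∩ E) s) := by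
  let mem : C → Set (Sym2 V) → Prop := fun c T => ∀ e ∈ Fix c, (e ∈ T ↔ e ∈ N c)
  let Ψ : Set (Sym2 V) → ℝ := fun T =>
    K₁ (openCluster (T ∩ E) s) (openCluster (Tᶜ ∩ E) s) * K₂ (openCluster (T ∩ E) s) (openCluster (Tᶜ ∩ E) s)
  -- the frozen set of a colouring: the union of the blue clusters of the vertices of `L`; the fixed pairs of its part
  let Z : Set (Sym2 V) → Set V := fun T => {v | ∃ Q ∈ L, v ∈ openCluster (Tᶜ ∩ E) Q}
  let FixOf : C → Set (Sym2 V) → Set (Sym2 V) := fun c T => Fix c ∪ {e | ∃ v ∈ Z T, v ∈ e}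
  set D' : Finset (Set (Sym2 V)) := D.filter (fun T => ∀ Q ∈ L, Q ∉ openCluster (Tᶜ ∩ E) s) with hD'
  -- the part of `T`: its box intersected with its freezing fibre
  let P : Set (Sym2 V) → Finset (Set (Sym2 V)) := fun T =>
    if h : T ∈ D then Finset.univ.filter (fun M => ∀ e ∈ FixOf (Classical.choose (hcover T h)) T, (e ∈ M ↔ e ∈ T)) else ∅
  have hP : ∀ T ∈ D, ∃ c, mem c T ∧ P T = Finset.univ.filter (fun M => ∀ e ∈ FixOf c T, (e ∈ M ↔ e ∈ T)) := by
    intro T hT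
    refine ⟨Classical.choose (hcover T hT), Classical.choose_spec (hcover T hT), ?_⟩
    simp only [P, dif_pos hT]
  -- membership in a part, unfolded
  have hmemP : ∀ (c : C) (T M : Set (Sym2 V)), mem c T →
      ((∀ e ∈ FixOf c T, (e ∈ M ↔ e ∈ T)) ↔ (mem c M ∧ ∀ e, (∃ v ∈ Z T, v ∈ e) → (e ∈ M ↔ e ∈ T))) := by
    intro c T M hTc
    constructor
    · intro h
      exact ⟨fun e he => by rw [h e (Or.inl he), hTc e he], fun e he => h e (Or.inr he)⟩
    · rintro ⟨h1, h2⟩ e (he | he)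
      · rw [h1 e he, hTc e he]
      · exact h2 e he
  -- `s` is outside the frozen set on `D'`
  have hs_notin : ∀ T ∈ D', s ∉ Z T := by
    intro T hT ⟨Q, hQL, hsQ⟩
    exact (Finset.mem_filter.1 hT).2 Q hQL (SimpleGraph.Reachable.symm hsQ)
  -- agreement on the pairs meeting `Z T` transports each blue cluster of `L`, hence `Z`
  have hcl_eq : ∀ T M : Set (Sym2 V), (∀ e, (∃ v ∈ Z T, v ∈ e) → (e ∈ M ↔ e ∈ T)) →
      ∀ Q ∈ L, openCluster (Mᶜ ∩ E) Q = openCluster (Tᶜ ∩ E) Q := by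
    intro T M hag Q hQL
    refine cluster_eq_of_agree E Q Tᶜ Mᶜ fun e he => ?_
    obtain ⟨v, hv, hve⟩ := he
    have := hag e ⟨v, ⟨Q, hQL, hv⟩, hve⟩
    rw [Set.mem_compl_iff, Set.mem_compl_iff]
    exact not_congr this
  have hZ_eq : ∀ T M : Set (Sym2 V), (∀ e, (∃ v ∈ Z T, v ∈ e) → (e ∈ M ↔ e ∈ T)) → Z M = Z T := by
    intro T M hag
    ext v
    simp only [Z, Set.mem_setOf_eq]
    constructor
    · rintro ⟨Q, hQL, hv⟩; exact ⟨Q, hQL, (hcl_eq T M hag Q hQL) ▸ hv⟩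
    · rintro ⟨Q, hQL, hv⟩; exact ⟨Q, hQL, (hcl_eq T M hag Q hQL).symm ▸ hv⟩
  -- boundary pairs of `Z T` are red in `T`
  have hboundary : ∀ (T : Set (Sym2 V)) (a b : V), a ∉ Z T → b ∈ Z T → s(a, b) ∈ E → s(a, b) ∈ T := by
    intro T a b ha hb he
    by_contra hab
    obtain ⟨Q, hQL, hbQ⟩ := hb
    exact ha ⟨Q, hQL, mem_cluster_of_edge hbQ (show s(b, a) ∈ Tᶜ ∩ E by rw [Sym2.eq_swap]; exact ⟨hab, he⟩)⟩
  refine sum_nonneg_of_parts D' Ψ P ?_ ?_ ?_ ?_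
  · -- `T` lies in its part
    intro T hT
    obtain ⟨c, hmem, hPT⟩ := hP T (Finset.mem_filter.1 hT).1
    rw [hPT]
    exact Finset.mem_filter.2 ⟨Finset.mem_univ _, fun e _ => Iff.rfl⟩
  · -- parts lie inside `D'`
    intro T hT M hM
    have hTD := (Finset.mem_filter.1 hT).1
    obtain ⟨c, hTc, hPT⟩ := hP T hTD
    rw [hPT] at hM
    obtain ⟨hMc, hag⟩ := (hmemP c T M hTc).1 (Finset.mem_filter.1 hM).2
    refine Finset.mem_filter.2 ⟨hinside c M hMc, fun Q hQL hQM => ?_⟩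
    have hsQ : s ∉ openCluster (Tᶜ ∩ E) Q := fun h => hs_notin T hT ⟨Q, hQL, h⟩
    refine not_reach_of_agree E s Q Tᶜ Mᶜ hsQ (fun e he => ?_) hQM
    obtain ⟨v, hv, hve⟩ := he
    have := hag e ⟨v, ⟨Q, hQL, hv⟩, hve⟩
    rw [Set.mem_compl_iff, Set.mem_compl_iff]
    exact not_congr this
  · -- parts are constant on themselves
    intro T hT M hM
    have hTD := (Finset.mem_filter.1 hT).1
    obtain ⟨c, hTc, hPT⟩ := hP T hTD
    rw [hPT] at hM
    obtain ⟨hMc, hag⟩ := (hmemP c T M hTc).1 (Finset.mem_filter.1 hM).2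
    have hMD : M ∈ D := hinside c M hMc
    obtain ⟨c', hMc', hPM⟩ := hP M hMD
    rw [hPM, hPT, huniq c' c M hMc' hMc]
    have hZMT : Z M = Z T := hZ_eq T M hag
    ext M'
    simp only [Finset.mem_filter, Finset.mem_univ, true_and]
    rw [hmemP c T M' hTc, hmemP c M M' hMc, hZMT]
    refine and_congr_right fun _ => forall_congr' fun e => ?_
    constructor
    · intro h he; rw [h he, hag e he]
    · intro h he; rw [h he, ← hag e he]
  · -- each part is a red-dominated box: fixed pairs `Fix c ∪ {pairs meeting Z T}`, pattern `T`
    intro T hT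
    have hTD := (Finset.mem_filter.1 hT).1
    obtain ⟨c, hTc, hPT⟩ := hP T hTD
    rw [hPT]
    have hd : ∀ M M' : Set (Sym2 V), (∀ e ∈ FixOf c T, (e ∈ M ↔ e ∈ T)) → (∀ e ∈ FixOf c T, (e ∈ M' ↔ e ∈ T)) →
        (∀ e ∉ FixOf c T, (e ∈ M' ↔ e ∉ M)) → openCluster (M'ᶜ ∩ E) s ⊆ openCluster (M ∩ E) s := by
      intro M M' hM hM' hflip
      obtain ⟨hMc, -⟩ := (hmemP c T M hTc).1 hM
      obtain ⟨hM'c, hagM'⟩ := (hmemP c T M' hTc).1 hM'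
      exact dom_freeze E s (Fix c) (N c) (hdom c) (Z T) (hs_notin T hT) T (hboundary T) M M' hMc hM'c hagM'
        (fun e he hne => hflip e (fun h => h.elim he hne))
    have h := box_sum_nonneg E s (FixOf c T) T hd hK₁ hso₁ hK₂ hso₂
    -- (the two filters carry different `DecidablePred` instances: compare them extensionally)
    refine le_of_le_of_eq h (Finset.sum_congr ?_ fun _ _ => rfl)
    ext M
    simp only [Finset.mem_filter, Finset.mem_univ, true_and]

/-- **Block freezing in box form (HOME/THEOREM-OneSided.md Lemma 2), super-odd `K`-form.**  On EVERY finite edge set `E` with source `s`,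
for every set of vertices `L` and all super-odd twisted-monotone `K₁, K₂`:
`0 ≤ Σ_{T : no vertex of L lies in Y T} K₁(X T, Y T)·K₂(X T, Y T)`. [this work] -/
theorem notY_sum_nonneg (E : Set (Sym2 V)) (s : V) (L : Set V) {K₁ K₂ : Set V → Set V → ℝ}
    (hK₁ : ∀ ⦃P P' Q Q' : Set V⦄, P ⊆ P' → Q' ⊆ Q → K₁ P Q ≤ K₁ P' Q') (hso₁ : ∀ P Q, 0 ≤ K₁ P Q + K₁ Q P)
    (hK₂ : ∀ ⦃P P' Q Q' : Set V⦄, P ⊆ P' → Q' ⊆ Q → K₂ P Q ≤ K₂ P' Q') (hso₂ : ∀ P Q, 0 ≤ K₂ P Q + K₂ Q P) :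
    0 ≤ ∑ T ∈ Finset.univ.filter (fun T : Set (Sym2 V) => ∀ Q ∈ L, Q ∉ openCluster (Tᶜ ∩ E) s),
      K₁ (openCluster (T ∩ E) s) (openCluster (Tᶜ ∩ E) s) * K₂ (openCluster (T ∩ E) s) (openCluster (Tᶜ ∩ E) s) := by
  -- the whole cube is one red-dominated box (nothing fixed): the antipode of `T` is `Tᶜ`, and `Y Tᶜ = X T`
  refine freeze_boxes_sum_nonneg E s Finset.univ (fun _ : Unit => (∅ : Set (Sym2 V))) (fun _ => ∅)
    (fun T _ => ⟨(), fun e he => absurd he (Set.notMem_empty e)⟩) (fun _ T _ => Finset.mem_univ T) (fun _ _ _ _ _ => rfl)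
    (fun _ T T' _ _ hflip => ?_) L hK₁ hso₁ hK₂ hso₂
  have hTT : T'ᶜ = T := by
    ext e
    rw [Set.mem_compl_iff]
    constructor
    · intro he
      by_contra h
      exact he ((hflip e (Set.notMem_empty e)).2 h)
    · intro he he'
      exact (hflip e (Set.notMem_empty e)).1 he' he
  rw [hTT]

/-- **⊕ ⇒ M.**  If the ⊕-event `{T : P ∈ X T}` of `(E, s, P)` is partitioned into red-dominated boxes `(Fix c, N c)` — cover (every
colouring with `P ∈ X` lies in a box), inside (every member of a box has `P ∈ X`), uniqueness, domination — then for every vertex `Q` and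
all super-odd twisted-monotone `K₁, K₂` the MIXED sum is nonnegative:
`0 ≤ TII_E(P, Q; K) = Σ_{T : P ∈ X T, Q ∉ Y T} K₁(X T, Y T)·K₂(X T, Y T)`.
This is hypothesis (M) of `Antithetic.Pendant.handle_vertex_sum_nonneg_of` (the HANDLE PRINCIPLE). [this work] -/
theorem mixed_of_oplus_boxes {C : Type*} (E : Set (Sym2 V)) (s P Q : V) (Fix N : C → Set (Sym2 V))
    (hcover : ∀ T : Set (Sym2 V), P ∈ openCluster (T ∩ E) s → ∃ c, ∀ e ∈ Fix c, (e ∈ T ↔ e ∈ N c))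
    (hinside : ∀ c (T : Set (Sym2 V)), (∀ e ∈ Fix c, (e ∈ T ↔ e ∈ N c)) → P ∈ openCluster (T ∩ E) s)
    (huniq : ∀ c c' (T : Set (Sym2 V)), (∀ e ∈ Fix c, (e ∈ T ↔ e ∈ N c)) → (∀ e ∈ Fix c', (e ∈ T ↔ e ∈ N c')) → c = c')
    (hdom : ∀ c (T T' : Set (Sym2 V)), (∀ e ∈ Fix c, (e ∈ T ↔ e ∈ N c)) → (∀ e ∈ Fix c, (e ∈ T' ↔ e ∈ N c)) →
      (∀ e ∉ Fix c, (e ∈ T' ↔ e ∉ T)) → openCluster (T'ᶜ ∩ E) s ⊆ openCluster (T ∩ E) s)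
    {K₁ K₂ : Set V → Set V → ℝ}
    (hK₁ : ∀ ⦃P P' Q Q' : Set V⦄, P ⊆ P' → Q' ⊆ Q → K₁ P Q ≤ K₁ P' Q') (hso₁ : ∀ P Q, 0 ≤ K₁ P Q + K₁ Q P)
    (hK₂ : ∀ ⦃P P' Q Q' : Set V⦄, P ⊆ P' → Q' ⊆ Q → K₂ P Q ≤ K₂ P' Q') (hso₂ : ∀ P Q, 0 ≤ K₂ P Q + K₂ Q P) :
    0 ≤ ∑ T ∈ Finset.univ.filter (fun T : Set (Sym2 V) => P ∈ openCluster (T ∩ E) s ∧ Q ∉ openCluster (Tᶜ ∩ E) s),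
      K₁ (openCluster (T ∩ E) s) (openCluster (Tᶜ ∩ E) s) * K₂ (openCluster (T ∩ E) s) (openCluster (Tᶜ ∩ E) s) := by
  have h := freeze_boxes_sum_nonneg E s (Finset.univ.filter (fun T : Set (Sym2 V) => P ∈ openCluster (T ∩ E) s)) Fix N
    (fun T hT => hcover T (Finset.mem_filter.1 hT).2) (fun c T hT => Finset.mem_filter.2 ⟨Finset.mem_univ _, hinside c T hT⟩)
    huniq hdom {Q} hK₁ hso₁ hK₂ hso₂
  rw [Finset.filter_filter] at h
  convert h using 2
  ext T
  simp only [Finset.mem_filter, Finset.mem_univ, true_and, Set.mem_singleton_iff, forall_eq]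

/-- **(M) at the source, on every graph.**  For every finite edge set `E`, source `s`, vertex `Q` and all super-odd twisted-monotone
`K₁, K₂`: `0 ≤ Σ_{T : s ∈ X T, Q ∉ Y T} K₁(X T, Y T)·K₂(X T, Y T)` (the conjunct `s ∈ X T` is vacuous; this is the shape of hypothesis (M)
of the handle principle with `P = s`). [this work] -/
theorem mixed_source_nonneg (E : Set (Sym2 V)) (s Q : V) {K₁ K₂ : Set V → Set V → ℝ}
    (hK₁ : ∀ ⦃P P' Q Q' : Set V⦄, P ⊆ P' → Q' ⊆ Q → K₁ P Q ≤ K₁ P' Q') (hso₁ : ∀ P Q, 0 ≤ K₁ P Q + K₁ Q P)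
    (hK₂ : ∀ ⦃P P' Q Q' : Set V⦄, P ⊆ P' → Q' ⊆ Q → K₂ P Q ≤ K₂ P' Q') (hso₂ : ∀ P Q, 0 ≤ K₂ P Q + K₂ Q P) :
    0 ≤ ∑ T ∈ Finset.univ.filter (fun T : Set (Sym2 V) => s ∈ openCluster (T ∩ E) s ∧ Q ∉ openCluster (Tᶜ ∩ E) s),
      K₁ (openCluster (T ∩ E) s) (openCluster (Tᶜ ∩ E) s) * K₂ (openCluster (T ∩ E) s) (openCluster (Tᶜ ∩ E) s) := by
  have h := notY_sum_nonneg E s {Q} hK₁ hso₁ hK₂ hso₂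
  convert h using 2
  ext T
  simp only [Finset.mem_filter, Finset.mem_univ, true_and, Set.mem_singleton_iff, forall_eq, mem_openCluster_self]

end Box

end Antithetic

end Summit.CriticalPhenomena.PercolationContinuityZ3.Theorems
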